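import Summits.QuantumFields.YangMills.Theorems.FluctuationComparisonRegPrIntLS2BetaCornerOfRecord
import HarnessLib

/-!
# S2β · DET-REP-B‴ — THE TWO-CORNER EDGE: the (E0)-inhabitant of `EdgeRows` and the path-freeness of the corner slice Hessians

Definition-free helper for `Cruxes/FluctuationComparisonRegPrIntL/Lines/semiclassical_s2beta.lean` (crux `stmt-QuantumFields-20520`; width seat `ym-ust-20520-w4`
g17; `--supports`, NOT a proof of any stub).  Sequel of ✓`…S2BetaCornerOfRecord` (p757383).  OBSERVATION OF RECORD (w4 g17 02:23Z, ★★OWNER-neutral, LEAD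
«agreed as stated»): the B‴ door reads `EdgeRows` only at `s ∈ {0,1}`; the organ's PATH content is the one clause `Icc 0 1 ⊆ I`.  Under the monotone re-cut
**(E0)** `IsOpen I ∧ 0 ∈ I ∧ 1 ∈ I` the edge rows are inhabited by LOCALLY CONSTANT data on the disconnected index set `I := Iio ½ ∪ Ioi ½`:

* ★★ `edgeRows_text_twoCorners` — from the per-value corner rows at `(A, y_A)` and `(B, y_B)` and the quadrilateral's off-bond agreement `A = B` off `bnd`:
  `IsOpen I ∧ 0 ∈ I ∧ 1 ∈ I ∧ ⟨EdgeRows … I bnd A B x y, by text⟩` for `x := (A on s < ½ ∣ B else)`, `y := (y_A ∣ y_B)` (via ✓`edgeRows_text_of_locallyConst`);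
* ★ `sliceHessEntry_congr` — the displayed slice-Hessian entry `((D[q ↦ Df(q) ∘ inr](s, e₀)) ∘ inr) v w` (the line's `hessStd`) depends only on the GERM of
  `f` at `(s, e₀)`;
* ★ `sliceHessEntry_of_locallyConst` — for `f q := Φ (x q.1) q.2` with `x =ᶠ[𝓝 s] X` it equals the entry for `q ↦ Φ X q.2`: at a locally constant corner the
  named matrices of DETN are PATH-FREE (and, by ✓`…S2BetaBoundPeano.fderiv_fderiv_slice_eq`, equal to the plain `y`-Hessian of `v ↦ Φ X (e₀ + v)` at `0`
  whenever `Φ X` is `C²` there).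

HONEST: bookkeeping; the corner rows at `B ≠ A` («the minimiser over `B` is read in the tube») and the VALUE rows DETN∕JACW are the organ and are NOT touched;
proves NO stub — EXW, GAP♯, DET-REP-B‴, H4ᶜ, LFR♯ᶜ, S2β and crux 20520 stay OPEN; rung R3 (YM₃ on T³) is NOT d = 4, NOT infinite volume, NOT a mass gap,
NOT Clay; the Yang–Mills mass gap is NOT proved.

References: [Balaban1985Variational] CMP 102 (1985) Thm 1 (8)–(10) p. 279; [Dieudonne1960] Ch. X §2 (10.2.1)–(10.2.3); [Balaban1985Averaging] CMP 98 (1985)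
§E Prop 6 p. 26–27.
-/

noncomputable section

open MeasureTheory Filter Topology Set Function Metric
open scoped ContDiff Matrix.Norms.L2Operator
open Literature.MathematicalPhysics.QuantumFieldTheory.Balaban1983to89
open Literature.MathematicalPhysics.QuantumFieldTheory.Balaban1983to89.T3ContinuumYM3Torus
open Literature.MathematicalPhysics.QuantumFieldTheory.Balaban1983to89.T4Continuum
open Summit.QuantumFields.YangMills.Theorems.FluctuationComparisonRegPrIntLWregGlue (WindowChart)
open Summit.QuantumFields.YangMills.Theorems.FluctuationComparisonRegPrIntLS2BetaCornerOfRecord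

namespace Summit.QuantumFields.YangMills.Theorems.FluctuationComparisonRegPrIntLS2BetaTwoCornerEdge

variable (F : T3Family) {J K : ℕ} (hJK : J ≤ K)

/-! ## §1 The two-corner edge on `I := Iio ½ ∪ Ioi ½` -/

/-- ★★ **THE (E0)-INHABITANT OF `EdgeRows`.**  For two window data `A, B` agreeing off `bnd` and per-value corner rows at `(A, y_A)`, `(B, y_B)` (window
membership, `y ∈ UV`, `0 < jV y`, fibrewise carrier, charted minimiser in `Sf` with action `m`), the LOCALLY CONSTANT data `x := (A on s < ½ ∣ B else)`,
`y := (y_A on s < ½ ∣ y_B else)` on the open, disconnected `I := Iio ½ ∪ Ioi ½ ∋ 0, 1` satisfy LINE g18-1's `EdgeRows` text (instantiate `θ := θBal_J`,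
`Sf := histGood`, `m := minActionRegPr F J K hJK ε₀`).  So under (E0) `IsOpen I ∧ 0 ∈ I ∧ 1 ∈ I` the edge rows carry exactly the two corners' readings.
[cite: Balaban1985Variational, Thm 1 (8)-(10) p.279] -/
theorem edgeRows_text_twoCorners
    {Sf : Set (GaugeField (F.P K) 0 (Matrix.specialUnitaryGroup (Fin 2) ℂ))} {O : Set (GaugeField (F.P J) 0 (Matrix.specialUnitaryGroup (Fin 2) ℂ))}
    (c : WindowChart F hJK Sf O) (θ : ℝ) (m : GaugeField (F.P J) 0 (Matrix.specialUnitaryGroup (Fin 2) ℂ) → ℝ)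
    {dV : ℕ} (σ : EuclideanSpace ℝ (Fin dV) → GaugeField (F.P K) 0 (Matrix.specialUnitaryGroup (Fin 2) ℂ))
    (UV : Set (EuclideanSpace ℝ (Fin dV))) (jV : EuclideanSpace ℝ (Fin dV) → ℝ)
    (bnd : PBond (F.P J) 0) {A B : GaugeField (F.P J) 0 (Matrix.specialUnitaryGroup (Fin 2) ℂ)}
    (hAB : ∀ e', e' ≠ bnd → A e' = B e') (hA : PlaqSmall θ A) (hB : PlaqSmall θ B)
    {yA yB : EuclideanSpace ℝ (Fin dV)}
    (hrowA : yA ∈ UV ∧ 0 < jV yA ∧ (∀ᶠ v in 𝓝 yA, c.jac (A, σ v) ≠ 0) ∧ c.Φ (A, σ yA) ∈ Sf ∧ wilsonAction4 (c.Φ (A, σ yA)) = m A)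
    (hrowB : yB ∈ UV ∧ 0 < jV yB ∧ (∀ᶠ v in 𝓝 yB, c.jac (B, σ v) ≠ 0) ∧ c.Φ (B, σ yB) ∈ Sf ∧ wilsonAction4 (c.Φ (B, σ yB)) = m B) :
    IsOpen (Iio (2⁻¹ : ℝ) ∪ Ioi 2⁻¹) ∧ (0 : ℝ) ∈ Iio (2⁻¹ : ℝ) ∪ Ioi 2⁻¹ ∧ (1 : ℝ) ∈ Iio (2⁻¹ : ℝ) ∪ Ioi 2⁻¹ ∧
    ((fun s : ℝ => if s < 2⁻¹ then A else B) 0 = A ∧ (fun s : ℝ => if s < 2⁻¹ then A else B) 1 = B ∧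
    ∀ s ∈ Iio (2⁻¹ : ℝ) ∪ Ioi 2⁻¹,
      PlaqSmall θ ((fun s : ℝ => if s < 2⁻¹ then A else B) s) ∧ (∀ e', e' ≠ bnd → (fun s : ℝ => if s < 2⁻¹ then A else B) s e' = A e') ∧
      ContinuousAt (fun s : ℝ => if s < 2⁻¹ then A else B) s ∧
      ContDiffAt ℝ ⊤ (fun s' : ℝ => fun b : PBond (F.P J) 0 =>
        (((fun s : ℝ => if s < 2⁻¹ then A else B) s' b : Matrix.specialUnitaryGroup (Fin 2) ℂ) : Matrix (Fin 2) (Fin 2) ℂ)) s ∧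
      (fun s : ℝ => if s < 2⁻¹ then yA else yB) s ∈ UV ∧ 0 < jV ((fun s : ℝ => if s < 2⁻¹ then yA else yB) s) ∧
      (∀ᶠ q in 𝓝 ((s : ℝ), (fun s : ℝ => if s < 2⁻¹ then yA else yB) s),
        c.jac ((fun s : ℝ => if s < 2⁻¹ then A else B) q.1, σ q.2) ≠ 0) ∧
      c.Φ ((fun s : ℝ => if s < 2⁻¹ then A else B) s, σ ((fun s : ℝ => if s < 2⁻¹ then yA else yB) s)) ∈ Sf ∧
      wilsonAction4 (c.Φ ((fun s : ℝ => if s < 2⁻¹ then A else B) s, σ ((fun s : ℝ => if s < 2⁻¹ then yA else yB) s))) =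
        m ((fun s : ℝ => if s < 2⁻¹ then A else B) s) ∧
      ContinuousAt (fun s : ℝ => if s < 2⁻¹ then yA else yB) s) := by
  have h0 : (0 : ℝ) < 2⁻¹ := by norm_num
  have h1 : ¬ (1 : ℝ) < 2⁻¹ := by norm_num
  refine ⟨isOpen_Iio.union isOpen_Ioi, Or.inl h0, Or.inr (by show (2⁻¹ : ℝ) < 1; norm_num), ?_⟩
  refine edgeRows_text_of_locallyConst F hJK c θ m σ UV jV (Iio (2⁻¹ : ℝ) ∪ Ioi 2⁻¹) bnd A B
    (fun s : ℝ => if s < 2⁻¹ then A else B) (fun s : ℝ => if s < 2⁻¹ then yA else yB) (if_pos h0) (if_neg h1) ?_ ?_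
  · -- local constancy on each half-line
    rintro s (hs | hs)
    · filter_upwards [Iio_mem_nhds hs] with s' hs'
      have hs0 : s < 2⁻¹ := hs
      have hs1 : s' < 2⁻¹ := hs'
      simp only [if_pos hs0, if_pos hs1, and_self]
    · filter_upwards [Ioi_mem_nhds hs] with s' hs'
      have hs0 : ¬ s < 2⁻¹ := not_lt.2 (le_of_lt hs)
      have hs1 : ¬ s' < 2⁻¹ := not_lt.2 (le_of_lt hs')
      simp only [if_neg hs0, if_neg hs1, and_self]
  · -- the per-value rows on each half-line
    intro s _
    split_ifs
    · exact ⟨hA, fun _ _ => rfl, hrowA⟩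
    · exact ⟨hB, fun e' he' => (hAB e' he').symm, hrowB⟩

/-! ## §2 The corner slice Hessians are path-free -/

/-- ★ **THE SLICE-HESSIAN ENTRY DEPENDS ONLY ON THE GERM.**  If `f =ᶠ[𝓝 (s, e₀)] g` then `((D[q ↦ Df(q) ∘ inr](s, e₀)) ∘ inr) v w` — the `(v, w)` entry of LINE
g18-1's `hessStd f` at `(s, e₀)` — equals the same expression for `g`. [cite: Dieudonne1960, Ch. X §2 (10.2.1) (bookkeeping)] -/
theorem sliceHessEntry_congr {S E : Type*} [NormedAddCommGroup S] [NormedSpace ℝ S] [NormedAddCommGroup E] [NormedSpace ℝ E]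
    {f g : S × E → ℝ} {s : S} {e₀ : E} (hfg : f =ᶠ[𝓝 ((s : S), e₀)] g) (v w : E) :
    ((fderiv ℝ (fun q : S × E => (fderiv ℝ f q).comp (ContinuousLinearMap.inr ℝ S E)) (s, e₀)).comp (ContinuousLinearMap.inr ℝ S E)) v w =
      ((fderiv ℝ (fun q : S × E => (fderiv ℝ g q).comp (ContinuousLinearMap.inr ℝ S E)) (s, e₀)).comp (ContinuousLinearMap.inr ℝ S E)) v w := by
  have h1 : (fun q : S × E => (fderiv ℝ f q).comp (ContinuousLinearMap.inr ℝ S E)) =ᶠ[𝓝 ((s : S), e₀)]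
      fun q : S × E => (fderiv ℝ g q).comp (ContinuousLinearMap.inr ℝ S E) :=
    (hfg.fderiv (𝕜 := ℝ)).mono fun q hq => by
      show (fderiv ℝ f q).comp (ContinuousLinearMap.inr ℝ S E) = (fderiv ℝ g q).comp (ContinuousLinearMap.inr ℝ S E)
      rw [hq]
  rw [h1.fderiv_eq]

/-- ★ **AT A LOCALLY CONSTANT CORNER THE NAMED SLICE HESSIAN IS PATH-FREE.**  For `f q := Φ (x q.1) q.2` with the datum path `x` eventually equal to `X` near `s`,
the slice-Hessian entry of `f` at `(s, e₀)` is that of `q ↦ Φ X q.2` — so under (E0), with `x := (U ∣ V)` locally constant, DETN's named matrices at the corners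
read `hessStd (q ↦ A(c.Φ(X, σ q.2)))` at the corner `X` alone (and then, where `v ↦ A(c.Φ(X, σ v))` is `C²`, the plain `y`-Hessian by
✓`…S2BetaBoundPeano.fderiv_fderiv_slice_eq`). [cite: Dieudonne1960, Ch. X §2 (10.2.3) (bookkeeping); Balaban1985Variational, Thm 1 (10) p.279] -/
theorem sliceHessEntry_of_locallyConst {S E α : Type*} [NormedAddCommGroup S] [NormedSpace ℝ S]
    [NormedAddCommGroup E] [NormedSpace ℝ E]
    (Φ : α → E → ℝ) {x : S → α} {X : α} {s : S} (hx : ∀ᶠ s' in 𝓝 s, x s' = X) (e₀ : E) (v w : E) :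
    ((fderiv ℝ (fun q : S × E => (fderiv ℝ (fun q : S × E => Φ (x q.1) q.2) q).comp (ContinuousLinearMap.inr ℝ S E)) (s, e₀)).comp
        (ContinuousLinearMap.inr ℝ S E)) v w =
      ((fderiv ℝ (fun q : S × E => (fderiv ℝ (fun q : S × E => Φ X q.2) q).comp (ContinuousLinearMap.inr ℝ S E)) (s, e₀)).comp
        (ContinuousLinearMap.inr ℝ S E)) v w := by
  refine sliceHessEntry_congr (s := s) (e₀ := e₀) ?_ v w
  have h2 : ∀ᶠ q in 𝓝 ((s : S), e₀), x q.1 = X := by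
    have := hx.prod_inl (𝓝 e₀)
    rw [← nhds_prod_eq] at this
    exact this
  exact h2.mono fun q hq => by simp only [hq]

end Summit.QuantumFields.YangMills.Theorems.FluctuationComparisonRegPrIntLS2BetaTwoCornerEdge

end
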